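import Summits.Ventures.PercRepro.RankLevelSetLevelSplitAll
import Summits.Ventures.PercRepro.RankLevelSetLevelSixCap
import Summits.Ventures.PercRepro.RankLevelSetLevelSixCapT
import Summits.Ventures.PercRepro.RankLevelSetLevelSixMult
import Summits.Ventures.PercRepro.RankLevelSetLevelSixMult4

/-!
# PercRepro — THE LEVEL-`6` THRESHOLDS MADE UNCONDITIONAL ON THE SPLIT ROW (p8, S3)

`proofs/SUBCLAIM-S3-p8.md` §3. night-1's split chain gives level `5` for every `p ≥ 175` in the tree
(`c025_five_large_split`, RankLevelSetLevelSplitAll); p8's three level-`6` chains are conditional on level `5` from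
`535` / `468` / `287` — all `≥ 175`. So, unconditionally, for every finite matroid:
* **`c025_six_large_cap''`** — C-025 at level `6` for every `p ≥ 536` (the nullity cap);
* **`c025_six_large_capT''`** — for every `p ≥ 469` (cap + Lemma T);
* **`c025_six_large_mult''`** — for every `p ≥ 288` (cap + Lemma T + multiplicity);
* **`c025_six_large_mult4''`** — for every `p ≥ 256` (cap + Lemma T + multiplicity + Lemma T4) — the level-`6`
  frontier of the counting route.
Axioms: standard.
-/

open scoped Matroid

namespace PercRepro

namespace ThmN

variable {α : Type}

/-- **THEOREM C₆ (cap), unconditional**: level `6` for every `p ≥ 536`. -/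
theorem c025_six_large_cap'' (M : Matroid α) [M.Finite] (p : ℕ) (hp : 536 ≤ p) : RLS M p 6 :=
  c025_six_of_five_cap (fun M _ p hp => c025_five_large_split M p (by omega)) M p hp

/-- **THEOREM C₆ (cap + Lemma T), unconditional**: level `6` for every `p ≥ 469`. -/
theorem c025_six_large_capT'' (M : Matroid α) [M.Finite] (p : ℕ) (hp : 469 ≤ p) : RLS M p 6 :=
  c025_six_of_five_capT (fun M _ p hp => c025_five_large_split M p (by omega)) M p hp

/-- **THEOREM C₆ (cap + Lemma T + multiplicity), unconditional**: level `6` for every `p ≥ 288`. -/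
theorem c025_six_large_mult'' (M : Matroid α) [M.Finite] (p : ℕ) (hp : 288 ≤ p) : RLS M p 6 :=
  c025_six_of_five_mult (fun M _ p hp => c025_five_large_split M p (by omega)) M p hp

/-- **THEOREM C₆ (cap + Lemma T + multiplicity + Lemma T4), unconditional**: level `6` for every `p ≥ 256`. -/
theorem c025_six_large_mult4'' (M : Matroid α) [M.Finite] (p : ℕ) (hp : 256 ≤ p) : RLS M p 6 :=
  c025_six_of_five_mult4 (fun M _ p hp => c025_five_large_split M p (by omega)) M p hp

/-- The level-`6` frontier of the counting route in the vocabulary of `C025`: every `p ≥ 256`. -/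
theorem c025_six_large_mult4''' (M : Matroid α) [M.Finite] (p : ℕ) (hp : 256 ≤ p) :
    phiK p 6 * ({A : Set α | A ⊆ M.E ∧ M.eRk A = (p : ℕ∞) ∧ M.eRk (M.E \ A) = (6 : ℕ∞)}.ncard : ℚ) ≤
      ({A : Set α | A ⊆ M.E ∧ (6 : ℕ∞) < M.eRk A ∧ M.eRk A < (p : ℕ∞)}.ncard : ℚ) :=
  c025_six_large_mult4'' M p hp

end ThmN

end PercRepro
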